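import Literature.MathematicalPhysics.KineticTheory.HardSphereEulerProofs
import Literature.Analysis.FluidPDE.HardSphereFlowJointMeasurable
import HarnessLib

/-!
# `CollisionActivityTails` (stmt-AtomisticToContinuum-13734), line `SketchK1`: measurability of the
near-field kinetic tail sum

Helper file (`--supports stmt-AtomisticToContinuum-13734`) for the crux
`Summit.AtomisticToContinuum.HydrodynamicLimit.Theses.OneFlightGossipEngine.CollisionActivityTails`
(shared with `…Theses.TwoClocks.CollisionActivityTails`), skeleton line `SketchK1`, registered stub
`stub_nearFieldKineticTails` (statement `NearFieldKineticTails`).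

That stub asks, in the crux's own frame and quantifier shape, for two conjuncts about the
window-averaged near-field relative kinetic energy of a tagged sphere along the orbit,
`F²_i(z) = w⁻¹ ∫_s^{s+w} Σ_{j ≠ i, dist(x_j(t), x_i(t)) ≤ 2ε} |v_j(t) − v_i(t)|² dt`,
`w = τ (N+1)^{-1/3}`, `ε = hsDiameter σ N`:

* (measurability) `z ↦ Σ_i 𝟙{V < F²_i(z)} F²_i(z)` is a.e.-measurable for the local Gibbs law;
* (tails) its `L¹` tail above `V ≥ V₀` vanishes as `τ → ∞` after `N → ∞` — the "one-flight
  thinning" law of large numbers in the window length, OPEN under the true non-equilibrium law.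

This file closes the FIRST conjunct once and for all (`aemeasurable_sum_tailFn_nearFieldKinetic`),
for every `σ, N`, every flow, every window and every level, so that whoever proves the tail
conjunct only has to supply the estimate. The proof: the near-field relative kinetic energy
`relKineticNear · i r` is a measurable function of the configuration (a finite sum of `ite`s over
the measurable events `{j ≠ i ∧ dist_{𝕋³}(x_j, x_i) ≤ r}`, `Torus.measurable_geometry_sepVec`, of
continuous functions of the velocities); window integrals of measurable observables along a
hard-sphere flow on `𝕋³` are a.e.-measurable for every law carried by the good set of the flow
(joint measurability of the flow on its good set,
`HardSphereFlow.aemeasurable_intervalIntegral_comp_flow_torus`);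
and the local Gibbs law is carried by the good set because it is absolutely continuous with
respect to the Liouville measure (`localGibbsLaw_eq`, `localGibbsMeasure_absolutelyContinuous`,
`HardSphereFlow.measure_compl_good`). Composition with the measurable scalar tail functional
`tailFn V` and a finite sum finish.

References: C. Cercignani, R. Illner, M. Pulvirenti, *The Mathematical Theory of Dilute Gases*
(1994), §4.2, App. 4.A (measurability of time averages along the hard-sphere flow); H. Spohn,
*Large Scale Dynamics of Interacting Particles* (1991), Part I §2.3 (local Gibbs states).
-/

noncomputable section

open MeasureTheory Set Filter Topology
open scoped ENNReal

namespace Summit.AtomisticToContinuum.HydrodynamicLimit.Theorems.CollisionActivityTailsNearFieldKineticTails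

open Literature.MathematicalPhysics.KineticTheory Literature.Analysis.FluidPDE

/-! ## Vocabulary of the line (verbatim from the skeleton `SketchK1`) -/

/-- A hard-sphere flow of `N + 1` spheres of reduced diameter `σ` on `𝕋³` (the crux's `Φ N`). -/
abbrev Flow (σ : ℝ) (N : ℕ) : Type :=
  HardSphereFlow (Torus.geometry (Fin 3)) (hsDiameter σ N) (N + 1)

/-- Phase space of `N + 1` spheres on `𝕋³`. -/
abbrev Cfg (N : ℕ) : Type := Config (N + 1) (Fin 3) T3

/-- The crux's window `w_N = τ (N+1)^{-1/3}`. -/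
def window (τ : ℝ) (N : ℕ) : ℝ := τ * ((N : ℝ) + 1) ^ (-(1 / 3 : ℝ))

/-- The scalar tail functional `y ↦ 𝟙{V < y} y` (the crux's integrand is `(N+1)⁻¹ Σ_i tailFn V (a_i)`). -/
def tailFn (V y : ℝ) : ℝ := Set.indicator {y : ℝ | V < y} (fun y => y) y

/-- Minimal-image distance of two points of `𝕋³` (norm of the torus geometry's separation vector). -/
def tdist (x y : T3) : ℝ := ‖(Torus.geometry (Fin 3)).sepVec x y‖

/-- Near-field relative kinetic energy at `i`: `Σ_{j ≠ i, dist(x_j, x_i) ≤ r} |v_j − v_i|²`. -/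
def relKineticNear {N : ℕ} (z : Cfg N) (i : Fin (N + 1)) (r : ℝ) : ℝ :=
  ∑ j : Fin (N + 1), if j ≠ i ∧ tdist (z j).1 (z i).1 ≤ r then ‖(z j).2 - (z i).2‖ ^ 2 else 0

/-- `F²_i`: NEAR-FIELD KINETIC TERM — the window average of the near-field (radius `2ε`) relative kinetic energy at `i`
along the orbit (the streaming term of the co-moving virial on the cutoff shell). -/
def nearFieldKinetic {σ : ℝ} {N : ℕ} (Φ : Flow σ N) (τ s : ℝ) (i : Fin (N + 1)) (z : Cfg N) : ℝ :=
  (window τ N)⁻¹ * ∫ t in s..(s + window τ N), relKineticNear (Φ.flow t z) i (2 * hsDiameter σ N)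

/-- **NEAR-FIELD KINETIC MEASURABILITY** — the measurability conjunct of the line's statement
`NearFieldKineticTails` (stub `stub_nearFieldKineticTails`), split off as its own sub-goal and
freed of every restriction: for every reduced diameter `σ`, all profiles, every `N`, every flow,
every window length `τ`, start `s` and level `V`, the tail sum `z ↦ Σ_i 𝟙{V < F²_i(z)} F²_i(z)` is
a.e.-measurable for the local Gibbs law. -/
def NearFieldKineticMeasurable : Prop :=
  ∀ (σ : ℝ) (a₀ θ₀ : T3 → ℝ) (u₀ : T3 → V3) (N : ℕ) (Φ : Flow σ N) (τ s V : ℝ),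
    AEMeasurable (fun z => ∑ i : Fin (N + 1), tailFn V (nearFieldKinetic Φ τ s i z))
      (localGibbsLaw σ a₀ u₀ θ₀ N Φ)

/-! ## Measurability of the static observables -/

/-- The event "`j ≠ i` and the centre of `j` lies within distance `r` of the centre of `i`" is a
measurable set of configurations (the minimal-image distance of two centres is a measurable
function of the configuration, `Torus.measurable_geometry_sepVec`). -/
theorem measurableSet_near {N : ℕ} (j i : Fin (N + 1)) (r : ℝ) :
    MeasurableSet {z : Cfg N | j ≠ i ∧ tdist (z j).1 (z i).1 ≤ r} :=
  (MeasurableSet.const (j ≠ i)).inter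
    (measurableSet_le (Torus.measurable_geometry_sepVec.comp
      ((measurable_pi_apply j).fst.prodMk (measurable_pi_apply i).fst)).norm measurable_const)

/-- The near-field relative kinetic energy at `i` is a measurable function of the configuration: a
finite sum of `ite`s over the measurable events `{j ≠ i ∧ dist(x_j, x_i) ≤ r}` of the continuous
functions `|v_j − v_i|²`. -/
theorem measurable_relKineticNear {N : ℕ} (i : Fin (N + 1)) (r : ℝ) :
    Measurable fun z : Cfg N => relKineticNear z i r := by
  unfold relKineticNear
  refine Finset.measurable_sum _ fun j _ =>
    Measurable.ite (measurableSet_near j i r) ?_ measurable_const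
  exact (((measurable_pi_apply j).snd.sub (measurable_pi_apply i).snd).norm).pow_const _

/-! ## The local Gibbs law is carried by the good set of the flow -/

/-- The local Gibbs law is absolutely continuous with respect to the Liouville measure of the
hard-sphere domain (it is the local Gibbs measure, a density against Liouville). -/
theorem localGibbsLaw_absolutelyContinuous (σ : ℝ) (a₀ θ₀ : T3 → ℝ) (u₀ : T3 → V3) (N : ℕ)
    (Φ : Flow σ N) :
    localGibbsLaw σ a₀ u₀ θ₀ N Φ ≪ liouville (Torus.geometry (Fin 3)) (N + 1) (hsDiameter σ N) := by
  rw [localGibbsLaw_eq]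
  exact localGibbsMeasure_absolutelyContinuous σ a₀ u₀ θ₀ N Φ

/-- The complement of the good set of the flow is null for the local Gibbs law (the Liouville
measure of the bad set vanishes, `HardSphereFlow.measure_compl_good`, and the law is absolutely
continuous with respect to Liouville). -/
theorem localGibbsLaw_compl_good (σ : ℝ) (a₀ θ₀ : T3 → ℝ) (u₀ : T3 → V3) (N : ℕ)
    (Φ : Flow σ N) : localGibbsLaw σ a₀ u₀ θ₀ N Φ Φ.goodᶜ = 0 :=
  localGibbsLaw_absolutelyContinuous σ a₀ θ₀ u₀ N Φ Φ.measure_compl_good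

/-! ## Measurability of the window average along the orbit -/

/-- The window integral `z ↦ ∫_a^b Σ_{j ≠ i, near} |v_j(t) − v_i(t)|² dt` of the near-field relative
kinetic energy along the orbit is a.e.-measurable for the local Gibbs law (joint measurability of
the torus flow on its good set, which carries the law). -/
theorem aemeasurable_intervalIntegral_relKineticNear (σ : ℝ) (a₀ θ₀ : T3 → ℝ) (u₀ : T3 → V3)
    (N : ℕ) (Φ : Flow σ N) (i : Fin (N + 1)) (r a b : ℝ) :
    AEMeasurable (fun z : Cfg N => ∫ t in a..b, relKineticNear (Φ.flow t z) i r)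
      (localGibbsLaw σ a₀ u₀ θ₀ N Φ) :=
  Φ.aemeasurable_intervalIntegral_comp_flow_torus (measurable_relKineticNear i r) a b
    (localGibbsLaw_compl_good σ a₀ θ₀ u₀ N Φ)

/-- The near-field kinetic term `F²_i` is an a.e.-measurable function of the initial datum for the
local Gibbs law. -/
theorem aemeasurable_nearFieldKinetic (σ : ℝ) (a₀ θ₀ : T3 → ℝ) (u₀ : T3 → V3) (N : ℕ)
    (Φ : Flow σ N) (τ s : ℝ) (i : Fin (N + 1)) :
    AEMeasurable (fun z : Cfg N => nearFieldKinetic Φ τ s i z) (localGibbsLaw σ a₀ u₀ θ₀ N Φ) :=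
  (aemeasurable_intervalIntegral_relKineticNear σ a₀ θ₀ u₀ N Φ i (2 * hsDiameter σ N) s
    (s + window τ N)).const_mul _

/-- The tail `𝟙{V < F²_i} F²_i` of the near-field kinetic term of one particle is a.e.-measurable
for the local Gibbs law (`tailFn V` is measurable: the indicator of the measurable set `{V < ·}`
applied to the identity). -/
theorem aemeasurable_tailFn_nearFieldKinetic (σ : ℝ) (a₀ θ₀ : T3 → ℝ) (u₀ : T3 → V3) (N : ℕ)
    (Φ : Flow σ N) (τ s V : ℝ) (i : Fin (N + 1)) :
    AEMeasurable (fun z : Cfg N => tailFn V (nearFieldKinetic Φ τ s i z))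
      (localGibbsLaw σ a₀ u₀ θ₀ N Φ) :=
  (show Measurable (tailFn V) from
    measurable_id.indicator (measurableSet_lt measurable_const measurable_id)).comp_aemeasurable
    (aemeasurable_nearFieldKinetic σ a₀ θ₀ u₀ N Φ τ s i)

/-- **Measurability half of `stub_nearFieldKineticTails` (line `SketchK1`).** For every reduced
diameter `σ`, all profiles, every `N`, every hard-sphere flow `Φ` of `N + 1` spheres on `𝕋³`, every
window length `τ`, start `s` and level `V`, the tail sum `z ↦ Σ_i 𝟙{V < F²_i(z)} F²_i(z)` of the
window-averaged near-field relative kinetic energies along the orbit is a.e.-measurable for the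
local Gibbs law `localGibbsLaw σ a₀ u₀ θ₀ N Φ` — exactly the first conjunct of the registered
statement `NearFieldKineticTails`, with no restriction on `σ, τ, s, V`. -/
theorem aemeasurable_sum_tailFn_nearFieldKinetic (σ : ℝ) (a₀ θ₀ : T3 → ℝ) (u₀ : T3 → V3) (N : ℕ)
    (Φ : Flow σ N) (τ s V : ℝ) :
    AEMeasurable (fun z => ∑ i : Fin (N + 1), tailFn V (nearFieldKinetic Φ τ s i z))
      (localGibbsLaw σ a₀ u₀ θ₀ N Φ) :=
  Finset.aemeasurable_fun_sum _ fun i _ =>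
    aemeasurable_tailFn_nearFieldKinetic σ a₀ θ₀ u₀ N Φ τ s V i

/-- **STUB (measurability half of `stub_nearFieldKineticTails`, line `SketchK1`).** The tail sum
of the window-averaged near-field relative kinetic energies is a.e.-measurable for the local Gibbs
law, for all data (`aemeasurable_sum_tailFn_nearFieldKinetic`). -/
theorem stub_nearFieldKineticMeasurable : NearFieldKineticMeasurable :=
  aemeasurable_sum_tailFn_nearFieldKinetic

end Summit.AtomisticToContinuum.HydrodynamicLimit.Theorems.CollisionActivityTailsNearFieldKineticTails

end
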